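import Summits.QuantumFields.GaugeBoot.SlabKernelGram
import Literature.MathematicalPhysics.QuantumFieldTheory.LatticeRPMechanism
import HarnessLib

/-!
# Integrating out the rungs of an annulus of plaquettes: the slab kernel of the two holonomies (gauge-boot, L3 supplement: 2D slab gluing 4/5)

HONEST FRAMING (cell `pub-gaugeboot`, page 1 of every file): the venture produces certified bounds
on lattice expectations at stated coupling, gauge group, dimension and torus size; NOT a mass gap,
NOT a continuum limit, NOT a string tension; NOT Yang–Mills-summit-bearing (barriers
`FixedCouplingUltralocality`, `PerturbativeInvisibility`). Measure-theoretic bookkeeping for the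
POSITIVE two-dimensional result `TiltedBoxOddAxisRPTwoDim.lean`; it discharges nothing else.

Setting: a finite index set `ι` of links, the product `μ` of Haar probability measures on
`Ω = ι → G` (`LatticeRP.piMeasure (haarProbability G)`), a continuous central weight `ω` (the
one-plaquette Wilson weight), a sequence of RUNG links `r 0, r 1, …` and frozen neighbours
`a t, b t : Ω → G` which do not depend on the rung variables. The `t`-th plaquette of the annulus has
weight `ω(a_t · U(r (t+1)) · b_t⁻¹ · U(r t)⁻¹)`.

* `integral_eq_integral_update` — one-coordinate disintegration
  `∫ Φ dμ = ∫ (∫ Φ(U[l ↦ z]) dz) dμ(U)` (the splice trick of `LatticeRPMechanism` with `C = {l}`);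
* **`integral_mul_openChain`** (Migdal's recursion) — integrating the INTERIOR rungs of an open chain
  of `m` plaquettes leaves the convolution power
  `ω^{⋆m}(a_0 ⋯ a_{m-1} · U(r m) · (b_0 ⋯ b_{m-1})⁻¹ · U(r 0)⁻¹)` (`convPow ω m = (haarConv ω)^[m-1] ω`),
  by the one-rung identity `SlabKernel.integral_mul_conv_step`;
* **`integral_mul_annulus`** — for a CLOSED annulus of `2m` plaquettes (`r (2m) = r 0`), integrating
  all rungs leaves `slabKernel (convPow ω m) (a_0 ⋯ a_{2m-1}) (b_0 ⋯ b_{2m-1})` of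
  `SlabKernelGram.lean` (two open chains of length `m`, one more rung, then the class average) — the
  form whose Gram representation makes it a kernel of positive type.

All `[folklore]` (Fubini on the product Haar measure and translation invariance).
References: A. A. Migdal, Sov. Phys. JETP 42 (1975) 413; B. K. Driver, Commun. Math. Phys. 123 (1989)
575, §7; K. Osterwalder, E. Seiler, Ann. Phys. 110 (1978) 440, §2.
-/

noncomputable section

open MeasureTheory Filter Function
open Literature.MathematicalPhysics.QuantumLattice
open Literature.MathematicalPhysics.QuantumFieldTheory (haarProbability)
open Literature.MathematicalPhysics.QuantumFieldTheory.LatticeRP (piMeasure splice splice_eq_piecewise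
  measurable_splice measurePreserving_splice integral_comp_eq_of_measurePreserving)
open Literature.MathematicalPhysics.QuantumFieldTheory.CentralKernel (central_haarConv_iterate symm_haarConv_iterate)

namespace Summit.QuantumFields.GaugeBoot

namespace SlabKernel

variable {ι : Type*} [Fintype ι] [DecidableEq ι]
variable {G : Type*} [Group G] [TopologicalSpace G] [IsTopologicalGroup G] [CompactSpace G]
  [MeasurableSpace G] [BorelSpace G]

/-! ## One-coordinate disintegration of the product Haar measure -/

/-- **`∫ Φ dμ = ∫∫ Φ(U[l ↦ z]) dz dμ(U)`** for an integrable `Φ` on the product of Haar probability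
measures. [folklore] -/
theorem integral_eq_integral_update (l : ι) {Φ : (ι → G) → ℂ} (hΦm : Measurable Φ) {K : ℝ}
    (hΦb : ∀ U, ‖Φ U‖ ≤ K) :
    ∫ U, Φ U ∂(piMeasure (ι := ι) (haarProbability G)) =
      ∫ U, ∫ z, Φ (update U l z) ∂haarProbability G ∂(piMeasure (ι := ι) (haarProbability G)) := by
  set μ := piMeasure (ι := ι) (haarProbability G)
  have hsp := measurePreserving_splice (haarProbability G) ({l} : Finset ι)
  rw [← integral_comp_eq_of_measurePreserving hsp hΦm]
  have hint : Integrable (fun p : (ι → G) × (ι → G) => Φ (splice {l} p)) (μ.prod μ) :=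
    Integrable.of_bound ((hΦm.comp (measurable_splice _)).aestronglyMeasurable) K
      (ae_of_all _ fun p => hΦb _)
  rw [integral_prod _ hint]
  refine integral_congr_ae (ae_of_all _ fun U => ?_)
  dsimp only
  have he : ∀ Y : ι → G, splice {l} (U, Y) = update U l (Y l) := fun Y => by
    rw [splice_eq_piecewise]
    exact Finset.piecewise_singleton _ _ _
  simp_rw [he]
  exact integral_comp_eq_of_measurePreserving (measurePreserving_eval (fun _ : ι => haarProbability G) l)
    (Φ := fun z => Φ (update U l z)) (hΦm.comp (measurable_update' (a := l) |>.comp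
      (measurable_const.prodMk measurable_id)))

/-- **Integrating out one coordinate against a factor that does not see it**:
`∫ g Φ dμ = ∫ g(U) (∫ Φ(U[l ↦ z]) dz) dμ(U)`. [folklore] -/
theorem integral_mul_eq_integral_mul_update (l : ι) {g Φ : (ι → G) → ℂ} (hgm : Measurable g)
    (hΦm : Measurable Φ) {Kg K : ℝ} (hgb : ∀ U, ‖g U‖ ≤ Kg) (hΦb : ∀ U, ‖Φ U‖ ≤ K)
    (hg : ∀ U z, g (update U l z) = g U) :
    ∫ U, g U * Φ U ∂(piMeasure (ι := ι) (haarProbability G)) =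
      ∫ U, g U * ∫ z, Φ (update U l z) ∂haarProbability G ∂(piMeasure (ι := ι) (haarProbability G)) := by
  have hK : 0 ≤ Kg := (norm_nonneg _).trans (hgb (fun _ => 1))
  have h1 := integral_eq_integral_update l (Φ := fun U => g U * Φ U) (hgm.mul hΦm) (K := Kg * K)
    (fun U => by rw [norm_mul]; exact mul_le_mul (hgb U) (hΦb U) (norm_nonneg _) hK)
  rw [h1]
  refine integral_congr_ae (ae_of_all _ fun U => ?_)
  dsimp only
  simp_rw [hg U]
  exact integral_const_mul _ _

/-! ## Convolution powers and ordered products -/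

/-- The convolution power `ω^{⋆m} = (haarConv ω)^[m-1] ω` (`m ≥ 1`; `ω^{⋆0} := ω` is a junk value). -/
def convPow (ω : G → ℝ) (m : ℕ) : G → ℝ := (haarConv ω)^[m - 1] ω

omit [Fintype ι] [DecidableEq ι] in
/-- `ω ⋆ ω^{⋆m} = ω^{⋆(m+1)}` for `m ≥ 1`. [folklore] -/
theorem haarConv_convPow (ω : G → ℝ) {m : ℕ} (hm : 1 ≤ m) : haarConv ω (convPow ω m) = convPow ω (m + 1) := by
  unfold convPow
  rw [show m + 1 - 1 = (m - 1) + 1 by omega, Function.iterate_succ_apply']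

omit [Fintype ι] [DecidableEq ι] in
/-- `ω^{⋆1} = ω`. [folklore] -/
@[simp] theorem convPow_one (ω : G → ℝ) : convPow ω 1 = ω := rfl

omit [Fintype ι] [DecidableEq ι] in
/-- Convolution powers of a central weight are central. [folklore] -/
theorem convPow_central {ω : G → ℝ} (hω : ∀ g h, ω (h * g * h⁻¹) = ω g) (m : ℕ) (g h : G) :
    convPow ω m (h * g * h⁻¹) = convPow ω m g := central_haarConv_iterate hω _ _ _

omit [Fintype ι] [DecidableEq ι] in
/-- Convolution powers of a central symmetric weight are symmetric. [folklore] -/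
theorem convPow_inv {ω : G → ℝ} (hω : ∀ g h, ω (h * g * h⁻¹) = ω g) (hωi : ∀ g, ω g⁻¹ = ω g) (m : ℕ) (g : G) :
    convPow ω m g⁻¹ = convPow ω m g := symm_haarConv_iterate hω hωi _ _

omit [Fintype ι] [DecidableEq ι] in
/-- Convolution powers of a continuous weight are continuous. [folklore] -/
theorem continuous_convPow {ω : G → ℝ} (hω : Continuous ω) (m : ℕ) : Continuous (convPow ω m) :=
  Literature.MathematicalPhysics.QuantumFieldTheory.continuous_haarConv_iterate hω _

/-- The ordered product `a_0(U) a_1(U) ⋯ a_{m-1}(U)`. -/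
def oprod (a : ℕ → (ι → G) → G) (m : ℕ) (U : ι → G) : G := ((List.range m).map fun t => a t U).prod

omit [Fintype ι] [DecidableEq ι] [TopologicalSpace G] [IsTopologicalGroup G] [CompactSpace G] [MeasurableSpace G]
  [BorelSpace G] in
/-- `oprod a (m+1) = oprod a m * a m`. [folklore] -/
theorem oprod_succ (a : ℕ → (ι → G) → G) (m : ℕ) (U : ι → G) : oprod a (m + 1) U = oprod a m U * a m U := by
  unfold oprod
  exact List.prod_range_succ _ _

omit [Fintype ι] [DecidableEq ι] [TopologicalSpace G] [IsTopologicalGroup G] [CompactSpace G] [MeasurableSpace G]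
  [BorelSpace G] in
/-- `oprod a 1 = a 0`. [folklore] -/
@[simp] theorem oprod_one (a : ℕ → (ι → G) → G) (U : ι → G) : oprod a 1 U = a 0 U := by
  simp [oprod]

omit [Fintype ι] [DecidableEq ι] [TopologicalSpace G] [IsTopologicalGroup G] [CompactSpace G] [MeasurableSpace G]
  [BorelSpace G] in
/-- Splitting an ordered product: `oprod a (m + k) = oprod a m * oprod (a ∘ (m + ·)) k`. [folklore] -/
theorem oprod_add (a : ℕ → (ι → G) → G) (m k : ℕ) (U : ι → G) :
    oprod a (m + k) U = oprod a m U * oprod (fun t => a (m + t)) k U := by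
  unfold oprod
  rw [List.range_add, List.map_append, List.prod_append, List.map_map]
  rfl

omit [Fintype ι] [TopologicalSpace G] [IsTopologicalGroup G] [CompactSpace G] [MeasurableSpace G]
  [BorelSpace G] in
/-- An ordered product of frozen neighbours is frozen. [folklore] -/
theorem oprod_update {a : ℕ → (ι → G) → G} {l : ι} (ha : ∀ t U z, a t (update U l z) = a t U) (m : ℕ)
    (U : ι → G) (z : G) : oprod a m (update U l z) = oprod a m U := by
  unfold oprod
  congr 1
  exact List.map_congr_left fun t _ => ha t U z

omit [Fintype ι] [DecidableEq ι] [IsTopologicalGroup G] [CompactSpace G] [MeasurableSpace G] [BorelSpace G]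
  in
/-- An ordered product of continuous factors is continuous. [folklore] -/
theorem continuous_oprod [ContinuousMul G] {a : ℕ → (ι → G) → G} (ha : ∀ t, Continuous (a t)) (m : ℕ) :
    Continuous (oprod a m) := by
  induction m with
  | zero =>
    have h0 : oprod a 0 = fun _ : ι → G => (1 : G) := funext fun U => by simp [oprod]
    rw [h0]; exact continuous_const
  | succ m ih =>
    have hs : oprod a (m + 1) = fun U => oprod a m U * a m U := funext (oprod_succ a m)
    rw [hs]; exact ih.mul (ha m)

/-! ## The open chain (Migdal's recursion) -/

section Chain

variable (ω : G → ℝ) (r : ℕ → ι) (a b : ℕ → (ι → G) → G)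

/-- The weight of the `t`-th plaquette of the annulus, `ω(a_t · U(r(t+1)) · b_t⁻¹ · U(r t)⁻¹)`, as a
complex number. -/
def plaqWt (t : ℕ) (U : ι → G) : ℂ := (ω (a t U * U (r (t + 1)) * (b t U)⁻¹ * (U (r t))⁻¹) : ℂ)

/-- The invariant of the recursion after integrating the rungs `r 1, …, r (t-1)`:
`ω^{⋆t}(a_0⋯a_{t-1} · U(r t) · (b_0⋯b_{t-1})⁻¹ · U(r 0)⁻¹) · ∏_{t ≤ s < m} plaqWt s`. -/
def chainInv (m t : ℕ) (U : ι → G) : ℂ :=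
  (convPow ω t (oprod a t U * U (r t) * (oprod b t U)⁻¹ * (U (r 0))⁻¹) : ℂ) *
    ∏ s ∈ Finset.Ico t m, plaqWt ω r a b s U

variable {ω r a b}

omit [Fintype ι] [DecidableEq ι] in
/-- At `t = 1` the invariant is the full chain weight. [folklore] -/
theorem chainInv_one {m : ℕ} (hm : 1 ≤ m) (U : ι → G) :
    chainInv ω r a b m 1 U = ∏ s ∈ Finset.range m, plaqWt ω r a b s U := by
  rw [chainInv, Finset.range_eq_Ico, Finset.prod_eq_prod_Ico_succ_bot hm, convPow_one, oprod_one, oprod_one]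
  rfl

omit [Fintype ι] [DecidableEq ι] [TopologicalSpace G] [IsTopologicalGroup G] [CompactSpace G] [MeasurableSpace G]
  [BorelSpace G] in
/-- The plaquette weights are bounded by the sup of `ω`. [folklore] -/
theorem norm_plaqWt_le {C : ℝ} (hC : ∀ g, |ω g| ≤ C) (t : ℕ) (U : ι → G) : ‖plaqWt ω r a b t U‖ ≤ C := by
  rw [plaqWt, Complex.norm_real, Real.norm_eq_abs]; exact hC _

omit [Fintype ι] [DecidableEq ι] [CompactSpace G] [MeasurableSpace G] [BorelSpace G] in
/-- The plaquette weights are continuous (continuous frozen neighbours). [folklore] -/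
theorem continuous_plaqWt (hωc : Continuous ω) (ha : ∀ t, Continuous (a t)) (hb : ∀ t, Continuous (b t))
    (t : ℕ) : Continuous (plaqWt ω r a b t) :=
  Complex.continuous_ofReal.comp (hωc.comp ((((ha t).mul (continuous_apply _)).mul (hb t).inv).mul
    (continuous_apply _).inv))

variable [SecondCountableTopology G]

/-- **One step of the recursion**: integrating the rung `r t` turns the invariant at `t` into the
invariant at `t + 1` (`1 ≤ t < m`), against any bounded measurable factor `h` frozen along the
interior rungs. [folklore] -/
theorem integral_mul_chainInv_succ (hωc : Continuous ω) (hω : ∀ g h, ω (h * g * h⁻¹) = ω g)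
    {m : ℕ} (hinj : ∀ s t, s ≤ m → t ≤ m → r s = r t → s = t)
    (ha : ∀ t, Continuous (a t)) (hb : ∀ t, Continuous (b t))
    (hau : ∀ t s U z, 1 ≤ s → s < m → a t (update U (r s) z) = a t U)
    (hbu : ∀ t s U z, 1 ≤ s → s < m → b t (update U (r s) z) = b t U)
    {h : (ι → G) → ℂ} (hhm : Measurable h) {K : ℝ} (hhb : ∀ U, ‖h U‖ ≤ K)
    (hhu : ∀ s U z, 1 ≤ s → s < m → h (update U (r s) z) = h U)
    {t : ℕ} (ht1 : 1 ≤ t) (htm : t < m) :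
    ∫ U, h U * chainInv ω r a b m t U ∂(piMeasure (ι := ι) (haarProbability G)) =
      ∫ U, h U * chainInv ω r a b m (t + 1) U ∂(piMeasure (ι := ι) (haarProbability G)) := by
  obtain ⟨C, hC0, hC⟩ := exists_forall_abs_le_of_continuous hωc
  -- split off the plaquette `t` and regroup: `h · chainInv_t = g · Φ`, `g` frozen along `r t`
  set g : (ι → G) → ℂ := fun U => h U * ∏ s ∈ Finset.Ico (t + 1) m, plaqWt ω r a b s U with hg
  set Φ : (ι → G) → ℂ := fun U =>
    (convPow ω t (oprod a t U * U (r t) * (oprod b t U)⁻¹ * (U (r 0))⁻¹) : ℂ) * plaqWt ω r a b t U with hΦ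
  have hsplit : ∀ U, h U * chainInv ω r a b m t U = g U * Φ U := fun U => by
    rw [chainInv, Finset.prod_eq_prod_Ico_succ_bot htm, hg, hΦ]
    ring
  simp_rw [hsplit]
  -- measurability / bounds
  have hcontΦr : Continuous fun U : ι → G =>
      convPow ω t (oprod a t U * U (r t) * (oprod b t U)⁻¹ * (U (r 0))⁻¹) :=
    (continuous_convPow hωc t).comp ((((continuous_oprod ha t).mul (continuous_apply _)).mul
      (continuous_oprod hb t).inv).mul (continuous_apply _).inv)
  obtain ⟨Ct, hCt⟩ := (isCompact_univ (X := ι → G)).exists_bound_of_continuousOn hcontΦr.continuousOn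
  have hΦm : Measurable Φ := ((Complex.continuous_ofReal.comp hcontΦr).mul
    (continuous_plaqWt hωc ha hb t)).measurable
  have hΦb : ∀ U, ‖Φ U‖ ≤ Ct * C := fun U => by
    rw [hΦ, norm_mul]
    exact mul_le_mul (by rw [Complex.norm_real]; exact hCt U (Set.mem_univ _)) (norm_plaqWt_le hC t U)
      (norm_nonneg _) ((norm_nonneg _).trans (by rw [Complex.norm_real]; exact hCt U (Set.mem_univ _)))
  have hgm : Measurable g :=
    hhm.mul (Finset.measurable_prod _ fun s _ => (continuous_plaqWt hωc ha hb s).measurable)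
  have hgb : ∀ U, ‖g U‖ ≤ K * C ^ (Finset.Ico (t + 1) m).card := fun U => by
    rw [hg, norm_mul]
    refine mul_le_mul (hhb U) ?_ (norm_nonneg _) ((norm_nonneg _).trans (hhb U))
    rw [norm_prod]
    calc ∏ s ∈ Finset.Ico (t + 1) m, ‖plaqWt ω r a b s U‖ ≤ ∏ _s ∈ Finset.Ico (t + 1) m, C :=
          Finset.prod_le_prod (fun _ _ => norm_nonneg _) fun s _ => norm_plaqWt_le hC s U
      _ = C ^ (Finset.Ico (t + 1) m).card := Finset.prod_const C
  -- `g` does not see the rung `r t`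
  have hrt0 : r 0 ≠ r t := fun h0 => by
    have := hinj 0 t (Nat.zero_le _) htm.le h0; omega
  have hgu : ∀ U z, g (update U (r t) z) = g U := fun U z => by
    simp only [hg]
    rw [hhu t U z ht1 htm]
    congr 1
    refine Finset.prod_congr rfl fun s hs => ?_
    rw [Finset.mem_Ico] at hs
    have hs1 : r (s + 1) ≠ r t := fun h1 => by
      have := hinj (s + 1) t (by omega) htm.le h1; omega
    have hs2 : r s ≠ r t := fun h1 => by
      have := hinj s t (by omega) htm.le h1; omega
    simp only [plaqWt, hau s t U z ht1 htm, hbu s t U z ht1 htm, update_of_ne hs1, update_of_ne hs2]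
  rw [integral_mul_eq_integral_mul_update (r t) hgm hΦm hgb hΦb hgu]
  -- the one-rung integral
  refine integral_congr_ae (ae_of_all _ fun U => ?_)
  dsimp only
  rw [hg, chainInv, mul_assoc]
  congr 1
  rw [mul_comm]
  congr 1
  have hrt1 : r (t + 1) ≠ r t := fun h1 => by
    have := hinj (t + 1) t (by omega) htm.le h1; omega
  have hinner : ∀ z, Φ (update U (r t) z) =
      ((convPow ω t (oprod a t U * z * (oprod b t U)⁻¹ * (U (r 0))⁻¹) *
        ω (a t U * U (r (t + 1)) * (b t U)⁻¹ * z⁻¹) : ℝ) : ℂ) := fun z => by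
    simp only [hΦ, plaqWt, oprod_update (fun t' U' z' => hau t' t U' z' ht1 htm),
      oprod_update (fun t' U' z' => hbu t' t U' z' ht1 htm), hau t t U z ht1 htm, hbu t t U z ht1 htm,
      update_self, update_of_ne hrt0, update_of_ne hrt1, Complex.ofReal_mul]
  simp_rw [hinner]
  rw [integral_complex_ofReal, integral_mul_conv_step (convPow_central hω t) hω, haarConv_convPow ω ht1,
    oprod_succ, oprod_succ, mul_inv_rev]
  congr 2
  simp only [mul_assoc]

/-- **The open chain** (Migdal's recursion): integrating the interior rungs `r 1, …, r (m-1)` of a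
chain of `m ≥ 1` plaquettes, against a bounded measurable factor `h` frozen along them, leaves
`ω^{⋆m}(a_0⋯a_{m-1} · U(r m) · (b_0⋯b_{m-1})⁻¹ · U(r 0)⁻¹)`. [folklore] -/
theorem integral_mul_openChain (hωc : Continuous ω) (hω : ∀ g h, ω (h * g * h⁻¹) = ω g)
    {m : ℕ} (hm : 1 ≤ m) (hinj : ∀ s t, s ≤ m → t ≤ m → r s = r t → s = t)
    (ha : ∀ t, Continuous (a t)) (hb : ∀ t, Continuous (b t))
    (hau : ∀ t s U z, 1 ≤ s → s < m → a t (update U (r s) z) = a t U)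
    (hbu : ∀ t s U z, 1 ≤ s → s < m → b t (update U (r s) z) = b t U)
    {h : (ι → G) → ℂ} (hhm : Measurable h) {K : ℝ} (hhb : ∀ U, ‖h U‖ ≤ K)
    (hhu : ∀ s U z, 1 ≤ s → s < m → h (update U (r s) z) = h U) :
    ∫ U, h U * ∏ s ∈ Finset.range m, plaqWt ω r a b s U ∂(piMeasure (ι := ι) (haarProbability G)) =
      ∫ U, h U * (convPow ω m (oprod a m U * U (r m) * (oprod b m U)⁻¹ * (U (r 0))⁻¹) : ℂ)
        ∂(piMeasure (ι := ι) (haarProbability G)) := by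
  -- the invariant from `t = 1` to `t = m`
  have key : ∀ t, 1 ≤ t → t ≤ m →
      ∫ U, h U * ∏ s ∈ Finset.range m, plaqWt ω r a b s U ∂(piMeasure (ι := ι) (haarProbability G)) =
        ∫ U, h U * chainInv ω r a b m t U ∂(piMeasure (ι := ι) (haarProbability G)) := by
    intro t ht1 htm
    induction t, ht1 using Nat.le_induction with
    | base => simp_rw [chainInv_one hm]
    | succ t ht1 ih =>
      rw [ih (by omega)]
      exact integral_mul_chainInv_succ hωc hω hinj ha hb hau hbu hhm hhb hhu ht1 (by omega)
  rw [key m hm le_rfl]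
  refine integral_congr_ae (ae_of_all _ fun U => ?_)
  simp [chainInv]

end Chain

end SlabKernel

end Summit.QuantumFields.GaugeBoot

end
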